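import Literature.Topology.FourManifolds.SPC4HandlesNielsenReduction
import HarnessLib

/-!
# From slides and flips of every handle to all elementary Nielsen automorphisms

Topic `Literature/Topology/FourManifolds` (fact seat
`provefact-Literature.Topology.FourManifolds.lauden-f709dd520c`, Laudenbach–Poénaru's Lemma 2, the
"elementary exercise" of p. 340).  Pure group theory; everything **proved**, no named facts.

Let `G` be a group with a basis `e : G ≅ F_k`, `xᵢ = e⁻¹(of i)`, and `R ⊆ Aut G` a set closed
under composition (the automorphisms *realised* by based self-diffeomorphisms).  Suppose that
for every `i` there is a set `Hᵢ ⊆ G` ("the classes below the handle `i`"), closed under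
inverses and containing the other basis elements, such that

* **slides**: either every `xᵢ ↦ xᵢ w` (`w ∈ Hᵢ`) or every `xᵢ ↦ w xᵢ` (`w ∈ Hᵢ`) is the value
  at `xᵢ` of some `φ ∈ R` fixing `Hᵢ` pointwise, and
* **flip**: `xᵢ ↦ v xᵢ⁻¹ u` for some `u, v ∈ Hᵢ` is the value at `xᵢ` of some `φ ∈ R` fixing
  `Hᵢ` pointwise.

Then **every elementary Nielsen automorphism** `xᵢ ↦ xᵢ⁻¹`, `xᵢ ↦ xᵢ xⱼ` of `F_k`
(`nielsenGenerators k`), read in `G` through `e`, **lies in `R`**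
(`forall_nielsen_mem_of_slides_flips`): `σᵢ = S ∘ F ∘ S'` for suitable slides `S`, `S'`, and
`xᵢ ↦ xᵢ xⱼ` is a slide or `σᵢ ∘ S ∘ σᵢ`.

## References

* F. Laudenbach, V. Poénaru, *A note on 4-dimensional handlebodies*, Bull. Soc. Math. France
  100 (1972), §2, proof of Lemma 2 (p. 340). [LaudenbachPoenaruBSMF1972]
* D. L. Johnson, *Presentations of Groups* (1997), Ch. 3 §1, §4. [Johnson1997]
-/

noncomputable section

open Function

namespace Literature.Topology.FourManifolds

namespace RealiseAlgebra

variable {G : Type*} [Group G] {k : ℕ} (e : G ≃* FreeGroup (Fin k))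

/-- An automorphism of `G` is determined by its values on the basis `e⁻¹(of i)`: if they are
those of `e⁻¹ ∘ ν ∘ e`, the automorphism is `e⁻¹ ∘ ν ∘ e`. [folklore] -/
theorem eq_conj_of_apply_basis {φ : MulAut G} {ν : MulAut (FreeGroup (Fin k))}
    (h : ∀ i, φ (e.symm (FreeGroup.of i)) = e.symm (ν (FreeGroup.of i))) (c : G) :
    φ c = e.symm (ν (e c)) := by
  have hhom : φ.toMonoidHom.comp e.symm.toMonoidHom = e.symm.toMonoidHom.comp ν.toMonoidHom := by
    ext i
    simp only [MonoidHom.coe_comp, MulEquiv.coe_toMonoidHom, comp_apply]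
    exact h i
  have := congrArg (fun f : FreeGroup (Fin k) →* G => f (e c)) hhom
  simpa using this

variable (R : Set (MulAut G)) (hR : ∀ φ ∈ R, ∀ ψ ∈ R, φ * ψ ∈ R)
  (H : Fin k → Set G)
  (hx : ∀ i j, j ≠ i → e.symm (FreeGroup.of j) ∈ H i)
  (hinv : ∀ i, ∀ w ∈ H i, w⁻¹ ∈ H i)
  (hslide : ∀ i, (∀ w ∈ H i, ∃ φ ∈ R, (∀ w' ∈ H i, φ w' = w') ∧ φ (e.symm (FreeGroup.of i)) = e.symm (FreeGroup.of i) * w) ∨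
    (∀ w ∈ H i, ∃ φ ∈ R, (∀ w' ∈ H i, φ w' = w') ∧ φ (e.symm (FreeGroup.of i)) = w * e.symm (FreeGroup.of i)))
  (hflip : ∀ i, ∃ φ ∈ R, ∃ u ∈ H i, ∃ v ∈ H i, (∀ w' ∈ H i, φ w' = w') ∧
    φ (e.symm (FreeGroup.of i)) = v * (e.symm (FreeGroup.of i))⁻¹ * u)

include hR hinv hslide hflip in
/-- **The inversion `xᵢ ↦ xᵢ⁻¹` is realised**, by an element of `R` fixing `Hᵢ` pointwise.
[cite: LaudenbachPoenaruBSMF1972, §2, proof of Lemma 2 (p. 340)] -/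
theorem exists_inv (i : Fin k) : ∃ σ ∈ R, (∀ w' ∈ H i, σ w' = w') ∧
    σ (e.symm (FreeGroup.of i)) = (e.symm (FreeGroup.of i))⁻¹ := by
  obtain ⟨F, hFR, u, hu, v, hv, hFfix, hFx⟩ := hflip i
  rcases hslide i with hA | hB
  · -- slides `x ↦ x w`: `σ = S_v ∘ F ∘ S_{u⁻¹}`
    obtain ⟨Sa, hSaR, hSafix, hSax⟩ := hA v hv
    obtain ⟨Sb, hSbR, hSbfix, hSbx⟩ := hA u⁻¹ (hinv i u hu)
    refine ⟨Sa * F * Sb, hR _ (hR _ hSaR _ hFR) _ hSbR, fun w' hw' => ?_, ?_⟩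
    · simp only [MulAut.mul_apply, hSbfix w' hw', hFfix w' hw', hSafix w' hw']
    · have h2 : F (e.symm (FreeGroup.of i) * u⁻¹) = v * (e.symm (FreeGroup.of i))⁻¹ := by
        rw [map_mul, hFx, hFfix _ (hinv i u hu)]; group
      have h3 : Sa (v * (e.symm (FreeGroup.of i))⁻¹) = (e.symm (FreeGroup.of i))⁻¹ := by
        rw [map_mul, map_inv, hSax, hSafix v hv]; group
      simp only [MulAut.mul_apply, hSbx, h2, h3]
  · -- slides `x ↦ w x`: `σ = S_u ∘ F ∘ S_{v⁻¹}`
    obtain ⟨Sa, hSaR, hSafix, hSax⟩ := hB u hu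
    obtain ⟨Sb, hSbR, hSbfix, hSbx⟩ := hB v⁻¹ (hinv i v hv)
    refine ⟨Sa * F * Sb, hR _ (hR _ hSaR _ hFR) _ hSbR, fun w' hw' => ?_, ?_⟩
    · simp only [MulAut.mul_apply, hSbfix w' hw', hFfix w' hw', hSafix w' hw']
    · have h2 : F (v⁻¹ * e.symm (FreeGroup.of i)) = (e.symm (FreeGroup.of i))⁻¹ * u := by
        rw [map_mul, hFx, hFfix _ (hinv i v hv)]; group
      have h3 : Sa ((e.symm (FreeGroup.of i))⁻¹ * u) = (e.symm (FreeGroup.of i))⁻¹ := by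
        rw [map_mul, map_inv, hSax, hSafix u hu]; group
      simp only [MulAut.mul_apply, hSbx, h2, h3]

include hR hx hinv hslide hflip in
/-- **The right multiplication `xᵢ ↦ xᵢ xⱼ` is realised**, by an element of `R` fixing the
other basis elements. [cite: LaudenbachPoenaruBSMF1972, §2, proof of Lemma 2 (p. 340)] -/
theorem exists_mul {i j : Fin k} (hij : i ≠ j) : ∃ ρ ∈ R, (∀ m, m ≠ i → ρ (e.symm (FreeGroup.of m)) = e.symm (FreeGroup.of m)) ∧
    ρ (e.symm (FreeGroup.of i)) = e.symm (FreeGroup.of i) * e.symm (FreeGroup.of j) := by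
  have hxj : e.symm (FreeGroup.of j) ∈ H i := hx i j hij.symm
  rcases hslide i with hA | hB
  · obtain ⟨S, hSR, hSfix, hSx⟩ := hA _ hxj
    exact ⟨S, hSR, fun m hm => hSfix _ (hx i m hm), hSx⟩
  · -- `ρ = σ ∘ S_{xⱼ⁻¹} ∘ σ`
    obtain ⟨σ, hσR, hσfix, hσx⟩ := exists_inv e R hR H hinv hslide hflip i
    obtain ⟨S, hSR, hSfix, hSx⟩ := hB _ (hinv i _ hxj)
    refine ⟨σ * S * σ, hR _ (hR _ hσR _ hSR) _ hσR, fun m hm => ?_, ?_⟩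
    · simp only [MulAut.mul_apply, hσfix _ (hx i m hm), hSfix _ (hx i m hm)]
    · have h2 : S ((e.symm (FreeGroup.of i))⁻¹) = (e.symm (FreeGroup.of i))⁻¹ * e.symm (FreeGroup.of j) := by
        rw [map_inv, hSx]; group
      have h3 : σ ((e.symm (FreeGroup.of i))⁻¹ * e.symm (FreeGroup.of j)) = e.symm (FreeGroup.of i) * e.symm (FreeGroup.of j) := by
        rw [map_mul, map_inv, hσx, inv_inv, hσfix _ hxj]
      simp only [MulAut.mul_apply, hσx, h2, h3]

include hR hx hinv hslide hflip in
/-- **All elementary Nielsen automorphisms are realised.** [cite: LaudenbachPoenaruBSMF1972, §2, proof of Lemma 2 (p. 340)]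
[cite: Johnson1997, Ch. 3 §1 Def. 1] -/
theorem forall_nielsen_mem_of_slides_flips :
    ∀ ν ∈ nielsenGenerators k, ∃ φ ∈ R, ∀ c, φ c = e.symm (ν (e c)) := by
  rintro ν (⟨i, rfl⟩ | ⟨i, j, hij, rfl⟩)
  · obtain ⟨σ, hσR, hσfix, hσx⟩ := exists_inv e R hR H hinv hslide hflip i
    refine ⟨σ, hσR, eq_conj_of_apply_basis e fun m => ?_⟩
    by_cases hm : m = i
    · subst hm; rw [hσx, coe_nielsenInv, nielsenInvHom_of_self, map_inv]
    · rw [hσfix _ (hx i m hm), coe_nielsenInv, nielsenInvHom_of_ne hm]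
  · obtain ⟨ρ, hρR, hρfix, hρx⟩ := exists_mul e R hR H hx hinv hslide hflip hij
    refine ⟨ρ, hρR, eq_conj_of_apply_basis e fun m => ?_⟩
    by_cases hm : m = i
    · subst hm; rw [hρx, coe_nielsenMul, nielsenMulHom_of_self, map_mul]
    · rw [hρfix m hm, coe_nielsenMul, nielsenMulHom_of_ne hm]

end RealiseAlgebra

end Literature.Topology.FourManifolds
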